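import Mathlib
import HarnessLib
import Summits.NavierStokesRegularity.NavierStokesRegularity.Theses.LocalRuledPressureDoor
import Summits.NavierStokesRegularity.NavierStokesRegularity.Theorems.LocalRuledPressureDoorRuledPressureCollapseRung
import Summits.NavierStokesRegularity.NavierStokesRegularity.Theorems.LocalRuledPressureDoorRuledPressureCollapseWindowToEverywhere

/-!
# LocalRuledPressureDoor — crux `RuledPressureCollapse` (stmt-NavierStokesRegularity-27999) BY NAME

Route `LocalRuledPressureDoor` (ns-idea-6 LINE g6-1 «ruled pressure»; planner ns-idea-6 g6, critic idea-crit-4 g5; DIRECTOR-NS #237 (1)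
key ns-imp-p1 g4).  THE LEVER K3: a door-class profile (Type I in time, space–time Type-I decay, continuous on the open slab,
unit-viscosity Oseen–Duhamel identity, divergence-free slices) whose similarity Riesz pressure `P_t(y) = (−t)·Q[v(t)](√(−t) y)` obeys
the translation rule `P_t(y + h e) = P_t(y)` on a ball `B(c,r)` for `h ∈ [0,δ]` at every `t < 0` has `Q[v(t)] ≡ 0` on every slice.
This file is the kernel-checked composition of the birth skeleton `RuledPressureCollapse_birth.lean` (9b67e5faaad58f62) with its
two stubs, both landed: `localRuledPressureDoor_stub_windowToEverywhere` (window → everywhere by the real-analytic pressure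
gradient) and `localRuledPressureDoor_ruledDecayVanish` (a shift-ruled function with the apex inverse-square decay vanishes), fed by
the tree's apex bound `abs_profilePressure_le`.

WHAT THIS IS NOT: a statement about HYPOTHETICAL Type-I zoom profiles (the door certifies «parabolic zoom limits of local space–time
Type-I blow-ups are never pressureless», critic N1); the door's engine `PressurelessProfileRigidity` and its `Target` are separate
items; not 0056, not the summit; NS regularity OPEN / not proved.
-/

noncomputable section

set_option linter.dupNamespace false

namespace Summit.NavierStokesRegularity.NavierStokesRegularity.Theorems

open Set Function
open Literature.Analysis Literature.Analysis.FluidPDE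
open Summit.NavierStokesRegularity.NavierStokesRegularity.Theorems.LocalPressureProfileDoorPressureWindowToSlab
  (abs_profilePressure_le)

/-- **Crux `RuledPressureCollapse` (item 27999) BY NAME**: an `e`-ruled similarity pressure on one ball of every slice of a
door-class profile collapses — the Riesz pressure vanishes identically on every slice. -/
theorem localRuledPressureDoor_ruledPressureCollapse_proof : Theses.LocalRuledPressureDoor.RuledPressureCollapse := by
  intro C D v _hrate hdec hcont hmild hdiv e he c r δ hr hδ hrule t ht z
  have hall := localRuledPressureDoor_stub_windowToEverywhere D v hdec hcont hmild hdiv e c r δ hr t ht (hrule t ht)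
  obtain ⟨K, _hK0, hK⟩ := abs_profilePressure_le hdec hcont hmild hdiv
  have hzero := localRuledPressureDoor_ruledDecayVanish (fun y => (-t) * pressurePotential (v t) (Real.sqrt (-t) • y)) e he δ K
    hδ hall (fun y => hK t ht y)
  have hs : 0 < Real.sqrt (-t) := Real.sqrt_pos.2 (neg_pos.2 ht)
  have h1 := hzero ((Real.sqrt (-t))⁻¹ • z)
  simp only [smul_smul, mul_inv_cancel₀ hs.ne', one_smul] at h1
  exact (mul_eq_zero.1 h1).resolve_left (neg_ne_zero.2 ht.ne)

end Summit.NavierStokesRegularity.NavierStokesRegularity.Theorems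

end
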